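import Literature.MathematicalPhysics.QuantumFieldTheory.Balaban1983to89.B6Prop26DivKLevelPadV1L0
import Literature.MathematicalPhysics.QuantumFieldTheory.Balaban1983to89.B9Cor35GCubeInputsAtOne

/-!
# `Balaban1983to89.B9Thm33CubeAtOneRight` — [B9] THEOREM 3.3 AT `U = 1` FOR THE BOND-SECTOR CUBE LETTER `G_□(1)`: THE RIGHT ENTRY (3.42)₃ `G_□(1)∇*_ν`
# = [4] PROP. 2.6 (2.136)₃ `|(G∇*J)(x)| ≤ O(1)·Lʲη·e^{−δ₃d(y,y′)}|J|` AT k LEVELS FOR THE CUBE SEQUENCE `{Ω_n(□)}` (a level-0 family), in r05's scalar shape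
# (`thm33_cube_atOne_GDs`, twin of `B9Thm33CubeAtOne.thm33_cube_atOne_G`) and in p38's real-coordinate shape (`DsK`, `hGDs_cube`, `thm33_GK_cube_right`,
# twins of `B9Cor35GCubeInputsAtOne.DK ∕ hDG_cube ∕ thm33_GK_cube`) — sub-row G-B9-LETTERS, module M5.1b-G, cell GAPS G-B9-02 entry n = 2; endpoint E1 of
# programme RIGHT-ENTRY-L0 (the level-0 twins `B6OpTransposeV1L0` → … → `B6Prop26DivKLevelPadV1L0` of p38 ∕ p22's transposed-walk chain)

statement-level skeleton of published theorems with citation tags; proofs where landed; nothing here is a claim about the Yang–Mills mass gap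

Sources under audit (cell lit-balaban): T. Bałaban, *Propagators for lattice gauge theories in a background field*, Commun. Math. Phys. **99**
(1985) 389–434 [`Balaban1985BackgroundPropagators`, "B9"], Thm 3.3 p. 399, (3.42) p. 397, Cor. 3.5 p. 407, p. 409 l. 1–5; T. Bałaban, *Propagators and
renormalization transformations for lattice gauge theories. II*, Commun. Math. Phys. **96** (1984) 223–250 [`Balaban1984PropagatorsII`, "[4]"],
Prop. 2.6 (2.136) p. 247, (2.141) p. 247.  Unit `lit-balaban-p33` (p33 gen 101); question of p38 g43 (HOME/INBOX 2026-08-28T18:24:06Z); B9 fold owner r06,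
B6 fold owner r03, referee ref-4.

## WHAT IS PRINTED (verbatim up to notation)

[B9] p. 397 (3.42): «|(G′(U)λ)(x)|, |(∇_UG′(U)λ)(x)|, |(G′(U)∇*_Uλ)(x)|, |(Δ_UG′(U)λ)(x)| ≦ B₀[(Lʲη)², Lʲη, Lʲη, 1]e^{−δ₀d(y,y′)}|λ|»; p. 399 Thm 3.3: «the
operator G(U) (a = 1) satisfies the inequalities (3.42)–(3.47), with G′(U) replaced by G(U)»; p. 407 Cor. 3.5: «with U = 1, these theorems were proved in
[4]»; p. 409 l. 1–5: the cube operators «satisfy all the inequalities of Theorems 3.1–3.3»; [4] p. 247 Prop. 2.6 (2.136): «|(GJ)(x)|, |(∇GJ)(x)|,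
|(G∇*J)(x)|, |(ΔGJ)(x)| ≤ O(1)[(Lʲη)², Lʲη, Lʲη, 1]e^{−δ₃d(y,y′)}|J|», «Reasoning in the same way as in the proof of Proposition 2.2».

## WHY THIS FILE

p38's G-F4 `B9Cor35GCubeInputsAtOne.thm33_GK_cube` reads (2.136)₁,₂,₄ for the cube letter `G_□(1)` (the LEFT entries `G`, `∇_νG`, `ΔG`) from r05's
`B9Thm33CubeAtOne.thm33_cube_atOne_G` = `B6Prop26LapKLevelV1L0.prop26_2136_lap_kLevel_unconditional` at the cube sequence; the RIGHT entry `G_□(1)∇*_ν`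
((2.136)₃ ∕ (3.42)₃), needed by r06's `B9Ineq386RightEntry.gExt_rightEntry_of_386L` (hypothesis `h342R`) and `hasMajorant_GV_of_gradForm_comm` to transfer
the right entry to `G_□(Ṽ_□)` (cell GAPS G-B9-02, entry n = 2 of the bond-sector `EBlock`), is NOT of left-factor form; print proves it by the walk, and in the
tree it is p38 ∕ p22's transposed walk `G∇* = G₀∇* + R̃ᵀ(G∇*)`, whose level-0 twins (programme RIGHT-ENTRY-L0, this seat) end in
`B6Prop26DivKLevelPadV1L0.prop26_2136_div_kLevel_unconditional`.  THIS FILE instantiates it at the cube sequence (§1, r05's binders verbatim) and lifts it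
to p38's realified letters (§2–§3, p38's binders verbatim), so that G-F6's entry n = 2 has the same standing as entries n = 0, 1, 3.

## WHAT THIS FILE CERTIFIES (kernel-checked; 1 `def` with body (`DsK`), theorems; 0 `def … : Prop`, 0 sorry; standard axioms)

* §1 ★ `thm33_cube_atOne_GDs` — (2.136)₃ for `G_□(1) := GE (domCube i q) i.hcf (wCubeBond_pos i q hb₀)`: `∃ σ₁ > 0 ∀ 0 < σ ≤ σ₁ ∀ 0 < α < 1 ∃ A ≥ 0, M₂ > 0`
  such that for every member `i` above `M₂ ≤ L·M_h`, every cover cube `q` and direction `ν`: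
  `HasMajorant (geomT (cubeFamY i q)) (blkV1 …) (onFun G_□(1) * DVa ν i.cf) (A·(len_T y·|c_f|⁻¹)·e^{−((1−α)σ/2)d_T(y,y′)})`;
* §2 `DsK b i ν := conj b ((liftEndY 𝔸 (DVa ν i.cf)).restrictScalars ℝ)` — the realified flat `∇*_ν` of bond functions in physical units (r03's
  `DVa ν c_f = c_f·(S_ν⁻¹ − 1)`, = def-Y's `cdsB i 1 ν` by `Node00.OpsYOfLetters.cdsB_one`), the letter of (3.42)₃ at `U = 1`; ★★ `hGDs_cube` — from the
  scalar majorant of §1's shape, `GK b i q parS parB * DsK b i ν ≺ A·(geoCK i q).len a·e^{−δd}` over `toB6 (geoCK i q) Rr H` (p38's `hDG_cube` mirrored);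
* §3 ★★★ `thm33_GK_cube_right` — §1 read through §2: `∃ σ₁ ∀ σ α ∃ A M₂ ∀ i q Rr H parS parB` (`parS 1 = 1`, `parB 1 = 1`, `M₂ ≤ L·M_h`) `∀ ν`:
  `HasMajorant (toB6 (geoCK i q) Rr H) (blkBK i q) (GK b i q parS parB * DsK b i ν) (A·(geoCK i q).len a·e^{−((1−α)σ/2)·(geoCK i q).dist a a′})` — r06's
  `h342R` at `U = 1` (rate to be weakened ∕ matched with `thm33_GK_cube`'s `delta3 α (2σ)` by the consumer, `hasMajorant_mono`).

## HONEST SCOPE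

* `U = 1` only; the cube sequence's bond weights `wCubeBond` (r05); the rate of §1 ∕ §3 is the transposed walk's `(1−α)σ/2` (p38's
  `prop26_2136_div_kLevel_unconditional`), not the left entries' `delta3 α (2σ)` — both are «some δ₃ > 0 depending on d, L» as printed; the transfer to
  `G_□(Ṽ_□)` ((3.86)) is r06's ∕ p38's business and is NOT done here; nothing continuum, nothing on d = 4 specifically; NOT summit progress; YM mass gap NOT
  proved by any of this.  `--supports stmt-QuantumFields-19200` as helper.  Net new unproved facts: 0.
-/

noncomputable section

namespace Literature.MathematicalPhysics.QuantumFieldTheory.Balaban1983to89.B9Thm33CubeAtOneRight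

open LatticeFieldCalculus
open Node00
open Literature.MathematicalPhysics.QuantumFieldTheory.Balaban1983to89
open Literature.MathematicalPhysics.QuantumFieldTheory.Balaban1983to89.B6RandomWalk (HasMajorant hasMajorant_mono)
open Literature.MathematicalPhysics.QuantumFieldTheory.Balaban1983to89.B9Thm34Ext (toB6)
open Literature.MathematicalPhysics.QuantumFieldTheory.Balaban1983to89.B9Eq352DivFormLetters (conj)
open Literature.MathematicalPhysics.QuantumFieldTheory.Balaban1983to89.B6KLevelCensusIndexV1 (KIdx kGeo)
open Literature.MathematicalPhysics.QuantumFieldTheory.Balaban1983to89.B6Cover236MultiLevelBlocks (cubes)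
open Literature.MathematicalPhysics.QuantumFieldTheory.Balaban1983to89.B6Ineq2133TwoScaleV1 (onFun)
open Literature.MathematicalPhysics.QuantumFieldTheory.Balaban1983to89.B6SectAVectorModelV1 (GE)
open Literature.MathematicalPhysics.QuantumFieldTheory.Balaban1983to89.B6SectAOperatorsV1 (BondIdx)
open Literature.MathematicalPhysics.QuantumFieldTheory.Balaban1983to89.B6GlobalChartV1L0 (blkV1)
open Literature.MathematicalPhysics.QuantumFieldTheory.Balaban1983to89.B6Geom246MultiLevelTorusL0 (geomT)
open Literature.MathematicalPhysics.QuantumFieldTheory.Balaban1983to89.B6LapLegKLevelV1 (DVa)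
open Literature.MathematicalPhysics.QuantumFieldTheory.Balaban1983to89.B9CubeLettersOpsL0 (cubeFamY)
open Literature.MathematicalPhysics.QuantumFieldTheory.Balaban1983to89.B9CubeLettersBondOpsL0 (BlkCubeY GACubeY)
open Literature.MathematicalPhysics.QuantumFieldTheory.Balaban1983to89.B9CubeBondWeights (domCube wCubeBond_pos wCubeBond_band placed_cubeFamY)
open Literature.MathematicalPhysics.QuantumFieldTheory.Balaban1983to89.B6Prop26DivKLevelPadV1L0 (prop26_2136_div_kLevel_unconditional)
open Literature.MathematicalPhysics.QuantumFieldTheory.Balaban1983to89.B9CubeGeometryInputs (geoCK)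
open Literature.MathematicalPhysics.QuantumFieldTheory.Balaban1983to89.B9Cor35GpCubeInputsAtOne (hasMajorant_conj_of_liftY hasMajorant_toB6_of_geomT)
open Literature.MathematicalPhysics.QuantumFieldTheory.Balaban1983to89.B9Cor35GCubeInputsAtOne (blkBK GK geomT_len_mul)
open Literature.MathematicalPhysics.QuantumFieldTheory.Balaban1983to89.B9CubeLettersBondOpsAtOneIdentL0 (GACubeY_one_liftY)
open Literature.MathematicalPhysics.QuantumFieldTheory.Balaban1983to89.Node00 (SiteY CfgY SiteParY BondParY FBondY toKT liftY liftEndY liftEndY_liftY)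

variable {d ℓ : ℕ} {hd : 1 ≤ d + 1} {hL : Odd (ℓ + 1) ∧ 1 < ℓ + 1} {b₀ b₁ : ℝ}

/-! ## §1  [4] Prop. 2.6 (2.136)₃ at k levels for the cube-local `G_□(1)`: r05's shape -/

section Scalar

/-- ★ **[4] PROP. 2.6 (2.136)₃ AT k LEVELS FOR THE CUBE-LOCAL `G_□(1)`** (= [B9] Thm 3.3 (3.42)₃ at `U = 1` for `G_□`, the right entry `G_□∇*_ν`), one set of
constants for all members, cubes and directions — the level-0 twin `prop26_2136_div_kLevel_unconditional` of p38's transposed walk at the cube sequence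
`{Ω_n(□)}` (binders of r05's `thm33_cube_atOne_G` verbatim, with `α < 1` and the walk's rate `(1−α)σ/2`).
[cite: Balaban1985BackgroundPropagators, Thm 3.3 p.399, (3.42) p.397, Cor. 3.5 p.407, p.409 l.1–5; Balaban1984PropagatorsII, Prop. 2.6 (2.136) p.247 (third entry), (2.141) p.247] -/
theorem thm33_cube_atOne_GDs (hb₀ : 0 < b₀) (hb₁ : b₀ ≤ b₁) :
    ∃ σ₁ : ℝ, 0 < σ₁ ∧ ∀ (σ : ℝ), 0 < σ → σ ≤ σ₁ → ∀ (α : ℝ), 0 < α → α < 1 →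
    ∃ A M₂ : ℝ, 0 ≤ A ∧ 0 < M₂ ∧
    ∀ (i : KIdx d ℓ hd hL b₀ b₁) (q : ↥(cubes (toKT i).D.toDomains)), M₂ ≤ ((ℓ : ℝ) + 1) * i.Mh → ∀ ν : Fin (d + 1),
      HasMajorant (g := geomT (cubeFamY i q)) (blkV1 i.hN (cubeFamY i q))
        (onFun (GE (domCube i q) i.hcf (wCubeBond_pos i q hb₀)) * DVa ν i.cf)
        (fun y y' => A * ((geomT (cubeFamY i q)).len y * |i.cf|⁻¹) * Real.exp (-((1 - α) * σ / 2 * (geomT (cubeFamY i q)).dist y y'))) := by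
  obtain ⟨σ₁, hσ₁, h⟩ := prop26_2136_div_kLevel_unconditional d ℓ hd hL hb₀ hb₁
  refine ⟨σ₁, hσ₁, fun σ hσ hσ1 α hα hα1 => ?_⟩
  obtain ⟨A, M₂, hA, hM₂, h2⟩ := h σ hσ hσ1 α hα hα1
  refine ⟨A, M₂, hA, hM₂, fun i q hM ν => ?_⟩
  exact h2 i.m i.K i.hN (cubeFamY i q) i.hk i.hk2 i.hMha i.hM8 i.hR2 i.hP5 i.hℓ (placed_cubeFamY i q) hM i.hcf
    (wCubeBond_pos i q hb₀) (wCubeBond_band i q hb₁) ν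

end Scalar

/-! ## §2  The realified right letter `∇*_ν` and the binder `hGDs` at the cube (p38's shape) -/

section Letters

variable {𝔸 : Type} [NormedRing 𝔸] [NormedAlgebra ℂ 𝔸] [CompleteSpace 𝔸]
variable {ι : Type} [Fintype ι] (b : Module.Basis ι ℝ 𝔸)
variable (i : KIdx d ℓ hd hL b₀ b₁) (q : ↥(cubes (toKT i).D.toDomains)) (parS : SiteParY 𝔸 i) (parB : BondParY 𝔸 i)

/-- **the flat adjoint covariant derivative `∇*_ν` of bond functions at `U = 1`** in physical units (`c_f·(S_ν⁻¹ − 1)`, r03's `DVa ν c_f`; def-Y's `cdsB i 1 ν`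
by `Node00.OpsYOfLetters.cdsB_one`), lifted to `𝔸` and realified — the letter of Theorem 3.3's (3.42)₃-entry `G∇*` (p38's `DK` mirrored).
[cite: Balaban1985BackgroundPropagators, (3.8) p.392, (3.42) p.397, Cor. 3.5 p.407; Balaban1984PropagatorsII, (2.136) p.247 (third entry)] -/
def DsK (ν : Fin (d + 1)) : Module.End ℝ (FBondY i × ι → ℝ) :=
  conj b ((liftEndY 𝔸 (DVa (P := B6GlobalChartV1.PV d ℓ i.m i.K hd hL) ν i.cf)).restrictScalars ℝ)

/-- ★★ **BINDER `hGDs` AT THE CUBE, DIRECTION `ν`** ((3.42)₃-type entry `G_□(1)∇*_ν`): from the scalar majorant `G·∇*_ν ≺ A·(len_T·|c_f|⁻¹)·e^{−δd}` of the cube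
sequence, `conj b(G_□(1))·conj b(∇*_ν) ≺ A·(Lⁿη)·e^{−δd}` over `toB6 (geoCK i □) Rr H` (p38's `hDG_cube` with the difference on the right).
[cite: Balaban1985BackgroundPropagators, Thm 3.3 p.399, (3.42)₃ p.397, Cor. 3.5 p.407, p.409 l.1–5; Balaban1984PropagatorsII, Prop. 2.6 (2.136)₃ p.247, (2.51) p.232] -/
theorem hGDs_cube (hb₀ : 0 < b₀) (hparS : ∀ z w, parS (fun _ _ => 1) z w = 1) (hparB : ∀ s s', parB (fun _ _ => 1) s s' = 1) {A δ : ℝ} (Rr : ℝ) (H : Prop)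
    (ν : Fin (d + 1))
    (h₃ : HasMajorant (g := geomT (cubeFamY i q)) (blkV1 i.hN (cubeFamY i q))
      (onFun (GE (domCube i q) i.hcf (wCubeBond_pos i q hb₀)) * DVa ν i.cf)
      (fun y y' => A * ((geomT (cubeFamY i q)).len y * |i.cf|⁻¹) * Real.exp (-(δ * (geomT (cubeFamY i q)).dist y y')))) :
    HasMajorant (g := toB6 (geoCK i q) Rr H) (blkBK i q) (GK b i q parS parB * DsK b i ν)
      (fun a a' => A * (geoCK i q).len a * Real.exp (-(δ * (geoCK i q).dist a a'))) := by
  rw [DsK, GK, ← B9Eq352DivFormLetters.conj_mul]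
  have hT : ∀ (J : FBondY i → ℝ) (E : 𝔸),
      ((GACubeY i q parS parB (fun _ _ => 1)).restrictScalars ℝ * (liftEndY 𝔸 (DVa (P := B6GlobalChartV1.PV d ℓ i.m i.K hd hL) ν i.cf)).restrictScalars ℝ)
          (liftY J E) =
        liftY ((onFun (GE (domCube i q) i.hcf (wCubeBond_pos i q hb₀)) * DVa (P := B6GlobalChartV1.PV d ℓ i.m i.K hd hL) ν i.cf) J) E := by
    intro J E
    rw [Module.End.mul_apply, LinearMap.restrictScalars_apply, LinearMap.restrictScalars_apply, liftEndY_liftY,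
      GACubeY_one_liftY i q hb₀ hparS hparB, Module.End.mul_apply]
  refine hasMajorant_mono (g := toB6 (geoCK i q) Rr H) _
    (hasMajorant_conj_of_liftY b (g := toB6 (geoCK i q) Rr H) (blkV1 i.hN (cubeFamY i q)) _ _ hT (hasMajorant_toB6_of_geomT i q Rr H h₃)) fun a a' => ?_
  rw [geomT_len_mul]

end Letters

/-! ## §3  ★★★ Theorem 3.3 (3.42)₃ at `U = 1` for the realified cube letter: all members and cubes, one set of constants -/

section Main

variable {𝔸 : Type} [NormedRing 𝔸] [NormedAlgebra ℂ 𝔸] [CompleteSpace 𝔸]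
variable {ι : Type} [Fintype ι] (b : Module.Basis ι ℝ 𝔸)

/-- ★★★ **THEOREM 3.3 (3.42)₃ AT `U = 1` FOR `G = conj b(G_□(1))`, ALL MEMBERS AND CUBES, ONE SET OF CONSTANTS** (Cor. 3.5's input «with U = 1, these theorems
were proved in [4]», the right entry): for `0 < b₀ ≤ b₁` there is `σ₁ > 0` and, for every `0 < σ ≤ σ₁`, `0 < α < 1`, constants `A ≥ 0`, `M₂ > 0` such that
for every member `i` above `M₂ ≤ L·M_h`, every cover cube `□`, every `Rr, H`, every real basis `b` of `𝔸`, all transporter letters with `parS 1 = 1`,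
`parB 1 = 1`, and every direction `ν`: `G·∇*_ν ≺ A·(Lⁿη)·e^{−((1−α)σ/2)d}` over `toB6 (geoCK i □) Rr H` — r06's `B9Ineq386RightEntry.gExt_rightEntry_of_386L`
hypothesis `h342R` at `U = 1` (the companion of p38's `thm33_GK_cube`; the rates are matched by the consumer with `hasMajorant_mono`).
[cite: Balaban1985BackgroundPropagators, Thm 3.3 p.399, (3.42)₃ p.397, Cor. 3.5 p.407, p.409 l.1–5; Balaban1984PropagatorsII, Prop. 2.6 (2.136)₃ p.247, (2.141) p.247] -/
theorem thm33_GK_cube_right (hb₀ : 0 < b₀) (hb₁ : b₀ ≤ b₁) :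
    ∃ σ₁ : ℝ, 0 < σ₁ ∧ ∀ (σ : ℝ), 0 < σ → σ ≤ σ₁ → ∀ (α : ℝ), 0 < α → α < 1 →
    ∃ A M₂ : ℝ, 0 ≤ A ∧ 0 < M₂ ∧
    ∀ (i : KIdx d ℓ hd hL b₀ b₁) (q : ↥(cubes (toKT i).D.toDomains)) (Rr : ℝ) (H : Prop) (parS : SiteParY 𝔸 i) (parB : BondParY 𝔸 i),
      (∀ z w, parS (fun _ _ => 1) z w = 1) → (∀ s s', parB (fun _ _ => 1) s s' = 1) → M₂ ≤ ((ℓ : ℝ) + 1) * i.Mh →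
      ∀ ν : Fin (d + 1), HasMajorant (g := toB6 (geoCK i q) Rr H) (blkBK i q) (GK b i q parS parB * DsK b i ν)
        (fun a a' => A * (geoCK i q).len a * Real.exp (-((1 - α) * σ / 2 * (geoCK i q).dist a a'))) := by
  obtain ⟨σ₁, hσ₁, h⟩ := thm33_cube_atOne_GDs (d := d) (ℓ := ℓ) (hd := hd) (hL := hL) hb₀ hb₁
  refine ⟨σ₁, hσ₁, fun σ hσ hσ1 α hα hα1 => ?_⟩
  obtain ⟨A, M₂, hA, hM₂, h2⟩ := h σ hσ hσ1 α hα hα1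
  refine ⟨A, M₂, hA, hM₂, fun i q Rr H parS parB hparS hparB hM ν => ?_⟩
  exact hGDs_cube b i q parS parB hb₀ hparS hparB Rr H ν (h2 i q hM ν)

end Main

end Literature.MathematicalPhysics.QuantumFieldTheory.Balaban1983to89.B9Thm33CubeAtOneRight

end
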